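import Literature.Probability.RandomPlanarGeometry.SLEPointStrongMarkov
import Literature.Probability.RandomPlanarGeometry.SLEDerivRatioMoments
import Literature.Probability.RandomPlanarGeometry.SLEOnePointEstimate
import Literature.Probability.RandomPlanarGeometry.RohdeSchrammCor35Proofs
import HarnessLib

/-!
# The sharp one-point estimate for the SLE_κ trace, upper half: `P[dist(z, γ) ≤ ε] ≤ C (ε/Im z)^{1-κ/8}`

Topic `Probability/RandomPlanarGeometry`; theorems only (no named fact). For `0 < κ < 8` we prove
the **upper half of the one-point estimate at the critical exponent** `1 - κ/8 = 2 - d`,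
`d = 1 + κ/8`:

* `exists_measureReal_sleRatioReach_le` — there is `C` with
  `P[ ψ(z) reaches λ before T_z ] ≤ C λ^{-(1-κ/8)}` for all `z ∈ ℍ`, `λ ≥ 1`, where
  `ψₜ(z) = (Im z)|gₜ'(z)|/Im gₜ(z)` is Rohde–Schramm's ratio (i.e. `P[Z(z) ≥ λ] ≤ C λ^{-(1-κ/8)}`
  for `Z(z) = sup_{t<T_z} ψₜ(z)`, *Basic properties of SLE*, Ann. of Math. 161 (2005), Lemma 6.3,
  whose moment bound gives this only for exponents `a < 1 - κ/8`);
* `measure_infDist_sleTrace_le_critical` — under `HasSLETrace κ`, there is `C` with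
  `P[ dist(z, γ[0,∞)) ≤ ε ] ≤ C (ε/Im z)^{1-κ/8}` for all `z ∈ ℍ`, `ε > 0` (Beffara, *The dimension
  of the SLE curves*, Ann. Probab. 36 (2008), Prop. 4, upper half; Lawler, *Conformally Invariant
  Processes in the Plane* (2005), Thm. 7.9, upper half; Lawler–Werness (2013), Lemmas 2.10–2.11 of
  arXiv:1011.3551, without the angular factor `S^β`). This is
  the diagonal case of the two-point estimate (Beffara (2008), §3 (3.5)) still missing for
  `Literature.Probability.RandomPlanarGeometry.ae_dimH_range_sleTrace`.

Proof (a renewal argument on the level reached by `ψ`, in place of the exact hypergeometric law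
of the printed proofs). Write `E_λ(z) = {ψ(z) reaches λ before T_z}` and `f(λ) = sup_z P[E_λ(z)]`.
For `λ ≥ 1`, `Λ > 1`, `K ≥ 0`, with `H` the time `ψ(z)` reaches `λ` and `w_H` the slope of the
centred flow `z_H = g_H(z) - W_H` there:

1. *optional stopping of the critical martingale* `Mₜ = ψₜ^{1-κ/8} Ĝ(wₜ)`,
   `Ĝ(w) = (1+w²)^{-(8-κ)/(2κ)}` (tree: `SLEDerivRatioTail`, `SLECriticalGhat`), at `H`:
   `λ^{1-κ/8} Ĝ(K) P[H < T_z, |w_H| ≤ K] ≤ E[M_H; H < T_z] ≤ M₀ = Ĝ(w₀) ≤ 1`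
   (`mul_measureReal_sleHitReached_inter_le`);
2. *restart at `H`* (strong Markov property of the ratio, `SLEPointStrongMarkov`): on
   `{H < T_z, |w_H| > K}` the ratio must still be multiplied by `Λ`, which an independent SLE_κ
   from the frozen point `z_H` of slope `> K` does with probability `≤ p_K(Λ)`;
3. *the subcritical moment bound with a profile tending to `1` at infinity*: for `0 < a < 1 - κ/8`
   the supersolution `G = 1 + D(1+w²)^{-β}` (`β > 0`) of `SLEMomentSupersolution` gives
   `E^x[Z^a] ≤ G(w_x)`, whence `p_K(Λ) ≤ D(1+K²)^{-β}/(Λ^a - 1) → 0` as `K → ∞`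
   (`measureReal_sleRatioReach_le_of_supersolution`);
4. hence `f(Λλ) ≤ Ĝ(K)⁻¹ λ^{-(1-κ/8)} + p_K(Λ) f(λ)`; with `Λ = 2` and `K` so large that
   `2^{1-κ/8} p_K(2) ≤ 1/2`, induction over dyadic levels gives `f(2^m) ≤ V 2^{-m(1-κ/8)}`, and
   monotonicity in `λ` concludes. The passage to `dist(z, γ)` is Rohde–Schramm's (6.2) (Koebe),
   `Loewner.IsGeneratedByCurve.le_infDist_range_of_derivRatio_le` of `SLEOnePointEstimate`.

## References

* V. Beffara, *The dimension of the SLE curves*, Ann. Probab. 36 (2008), Prop. 4.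
* G. F. Lawler, *Conformally Invariant Processes in the Plane*, AMS (2005), §7.4, Thm. 7.9.
* S. Rohde, O. Schramm, *Basic properties of SLE*, Ann. of Math. 161 (2005), Lemma 6.3, eq. (6.2),
  Thm. 8.1.
* G. F. Lawler, B. M. Werness, *Multi-point Green's functions for SLE and an estimate of Beffara*,
  Ann. Probab. 41 (2013) 1513–1555 (arXiv:1011.3551, Lemmas 2.10–2.11: the one-point estimate
  `P{Υ_∞(w) ≤ r Υ_D(w)} ≤ c r^{2-d} S_D(w)^β` and its distance form).
-/

noncomputable section

open Set Filter MeasureTheory Complex Metric Real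
open _root_.Topology
open scoped NNReal ENNReal

namespace Literature.Probability.RandomPlanarGeometry

open Loewner Literature.Probability.Process

variable {κ : ℝ≥0} {z : ℂ} {n : ℕ} {lam : ℝ}

/-! ### Step 1: optional stopping of the critical martingale at the hitting time -/

section OptionalStopping

/-- On `{H^n_λ ≤ T_s ∧ ρₙ}` with the level reached, the Tail-file stopping time
`S = H^n_λ ∧ T_s ∧ ρₙ` is `T = H^n_λ ∧ ρₙ`. [folklore] -/
theorem sleTailTime_eq_slePsiHitLocTime (hz : 0 < z.im) {s : ℝ} {ω : ℝ≥0 → ℝ}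
    (h : slePsiHitTime κ z lam n ω ≠ ⊤)
    (hC : slePsiHitTime κ z lam n ω ≤ sleCotArgLocTime κ z s n ω) :
    sleTailTime κ z s lam n ω = slePsiHitLocTime κ z lam n ω := by
  rw [sleTailTime, min_eq_left hC, slePsiHitLocTime_eq_of_ne_top hz h]

/-- `{H^n_λ ≤ ρₙ, |w_T| ≤ K}` is measurable. [folklore] -/
theorem measurableSet_sleHitReached_inter_le (hz : 0 < z.im) (lam K : ℝ) (n : ℕ) :
    MeasurableSet (sleHitReached κ z lam n ∩ {ω | |sleHitSlope κ z lam n ω| ≤ K}) := by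
  have hT := isStoppingTime_slePsiHitLocTime (κ := κ) hz lam n
  refine hT.measurableSpace_le _ ((measurableSet_sleHitReached hz lam n).inter ?_)
  exact measurableSet_le (continuous_abs.measurable.comp (measurable_sleHitSlope hz lam n))
    measurable_const

/-- **Optional stopping at `H^n_λ`, localised by the slope**: for `|w₀| < s`, `λ ≥ 1`, `0 < κ ≤ 8`,
`λ^{1-κ/8} Ĝ(K) · P[H^n_λ ≤ T_s ∧ ρₙ, |w_{H}| ≤ K] ≤ Ĝ(w₀)`, where `Ĝ = Ĝ_{1-κ/8,κ}` is the critical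
profile (`(1+w²)^{-(8-κ)/(2κ)}`): on that event the stopped critical observable
`M_S = ψ_S^{1-κ/8} Ĝ(w_S)` equals `λ^{1-κ/8} Ĝ(w_H) ≥ λ^{1-κ/8} Ĝ(K)`, and `E[M_S] = Ĝ(w₀)`.
[cite: RohdeSchramm2005, Lemma 6.3 (proof)] -/
theorem mul_measureReal_sleHitReached_inter_le_of_lt (hκ0 : 0 < κ) (hκ8 : κ ≤ 8) (hz : 0 < z.im)
    {s : ℝ} (h0 : |z.re / z.im| < s) (hlam : 1 ≤ lam) (K : ℝ) (n : ℕ) :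
    lam ^ (1 - (κ : ℝ) / 8) * rsGhatSlope (1 - (κ : ℝ) / 8) κ K *
        preWienerMeasure.real (sleHitReached κ z lam n ∩ {ω | |sleHitSlope κ z lam n ω| ≤ K} ∩
          {ω | slePsiHitTime κ z lam n ω ≤ sleCotArgLocTime κ z s n ω}) ≤
      rsGhatSlope (1 - (κ : ℝ) / 8) κ (z.re / z.im) := by
  haveI := isProbabilityMeasure_preWienerMeasure'
  have hκ0' : (0 : ℝ) < κ := by exact_mod_cast hκ0
  have hκ8' : (κ : ℝ) ≤ 8 := by exact_mod_cast hκ8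
  have hlam0 : 0 ≤ lam := zero_le_one.trans hlam
  set B : Set (ℝ≥0 → ℝ) := sleHitReached κ z lam n ∩ {ω | |sleHitSlope κ z lam n ω| ≤ K} ∩
    {ω | slePsiHitTime κ z lam n ω ≤ sleCotArgLocTime κ z s n ω} with hB
  have hBm : MeasurableSet B :=
    (measurableSet_sleHitReached_inter_le hz lam K n).inter
      (measurableSet_le (isStoppingTime_slePsiHitTime hz lam n).measurable'
        (isStoppingTime_sleCotArgLocTime hz s n).measurable')
  set c : ℝ := lam ^ (1 - (κ : ℝ) / 8) * rsGhatSlope (1 - (κ : ℝ) / 8) κ K with hc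
  have hGK := rsGhatSlope_critical_mem_Ioc hκ0' hκ8' K
  have hc0 : 0 ≤ c := mul_nonneg (rpow_nonneg hlam0 _) hGK.1.le
  set M : (ℝ≥0 → ℝ) → ℝ := fun ω ↦ stoppedProcess (sleRSObservable κ (1 - (κ : ℝ) / 8) z)
    (sleTailTime κ z s lam n) ((n : ℝ≥0) + 1) ω with hM
  -- pointwise: `c 𝟙_B ≤ M_S`
  have hptw : ∀ ω, c * B.indicator (1 : (ℝ≥0 → ℝ) → ℝ) ω ≤ M ω := by
    intro ω
    have hW := continuous_sleDriving κ ω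
    obtain ⟨u, hu⟩ := WithTop.ne_top_iff_exists.1
      (sleTailTime_ne_top (κ := κ) (z := z) (s := s) (lam := lam) (n := n) ω)
    have hu' : sleTailTime κ z s lam n ω = u := hu.symm
    have hMω : M ω = derivRatio (sleDriving κ ω) z u ^ (1 - (κ : ℝ) / 8) *
        rsGhatSlope (1 - (κ : ℝ) / 8) κ (cotArg (sleDriving κ ω) z u) :=
      stoppedProcess_critical_succ_eq hz hu'
    rw [hMω]
    have huρ : ((u : ℝ≥0) : WithTop ℝ≥0) ≤ slePointLocTime κ z n ω := hu' ▸ sleTailTime_le_locTime ω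
    have hlt := coe_lt_swallowingTime_of_le_locTime hz huρ
    have hψ0 : 0 ≤ derivRatio (sleDriving κ ω) z u := zero_le_one.trans (one_le_derivRatio hW hz hlt)
    have hG := rsGhatSlope_critical_mem_Ioc hκ0' hκ8' (cotArg (sleDriving κ ω) z u)
    by_cases hω : ω ∈ B
    · rw [indicator_of_mem hω, Pi.one_apply, mul_one]
      have hTeq : sleTailTime κ z s lam n ω = slePsiHitLocTime κ z lam n ω :=
        sleTailTime_eq_slePsiHitLocTime hz hω.1.1 hω.2
      have hur : u = (slePsiHitLocTime κ z lam n ω).untopA := by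
        rw [← hTeq, hu']
        rfl
      have hψ : derivRatio (sleDriving κ ω) z u = lam := by
        rw [hur]; exact derivRatio_untopA_slePsiHitLocTime_eq hz hlam hω.1.1
      have hw : cotArg (sleDriving κ ω) z u = sleHitSlope κ z lam n ω := by
        rw [hur, sleHitSlope_eq hz]
      rw [hψ, hw, hc]
      exact mul_le_mul_of_nonneg_left (rsGhatSlope_critical_le_of_abs_le hκ0' hκ8' hω.1.2)
        (rpow_nonneg hlam0 _)
    · rw [indicator_of_notMem hω, mul_zero]
      exact mul_nonneg (rpow_nonneg hψ0 _) hG.1.le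
  have hMint : Integrable M preWienerMeasure :=
    (martingale_stoppedProcess_critical hκ0 hz h0 lam n).integrable _
  have hind : Integrable (fun ω ↦ c * B.indicator (1 : (ℝ≥0 → ℝ) → ℝ) ω) preWienerMeasure :=
    ((integrable_const 1).indicator hBm).const_mul c
  have h := integral_mono hind hMint hptw
  rw [integral_const_mul, integral_indicator_one hBm] at h
  have hI : ∫ ω, M ω ∂preWienerMeasure = rsGhatSlope (1 - (κ : ℝ) / 8) κ (z.re / z.im) :=
    integral_stoppedProcess_critical hκ0 hz h0 lam n _
  rw [hI, hc] at h
  exact h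

/-- The slope exit times are non-decreasing in the level: `s ≤ s' ⟹ T_s ≤ T_{s'}`. [folklore] -/
theorem sleCotArgExitTime_mono (ω : ℝ≥0 → ℝ) {s s' : ℝ} (hss' : s ≤ s') :
    sleCotArgExitTime κ z s ω ≤ sleCotArgExitTime κ z s' ω := by
  change cotArgExitTime (sleDriving κ ω) z s ≤ cotArgExitTime (sleDriving κ ω) z s'
  unfold cotArgExitTime
  exact sInf_le_sInf (image_mono fun t ht ↦ ⟨ht.1, hss'.trans ht.2⟩)

/-- If `|w| < s` along `[0, ρₙ]` then `ρₙ ≤ T_s`. [folklore] -/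
theorem slePointLocTime_le_sleCotArgExitTime {s : ℝ} {ω : ℝ≥0 → ℝ}
    (h : ∀ t : ℝ≥0, (t : WithTop ℝ≥0) ≤ slePointLocTime κ z n ω → |cotArg (sleDriving κ ω) z t| < s) :
    slePointLocTime κ z n ω ≤ sleCotArgExitTime κ z s ω := by
  change slePointLocTime κ z n ω ≤ cotArgExitTime (sleDriving κ ω) z s
  unfold cotArgExitTime
  refine le_sInf ?_
  rintro _ ⟨t, ht, rfl⟩
  by_contra hlt
  rw [not_le] at hlt
  have := h t hlt.le
  exact absurd ht.2 (not_le.2 (by simpa using this))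

/-- **The slope is bounded along `[0, ρₙ]`** (a continuous function on a compact interval): there
is `N : ℕ` with `|wₜ| < |w₀| + 1 + N` for all `t ≤ ρₙ`. [folklore] -/
theorem exists_nat_abs_cotArg_lt (hz : 0 < z.im) (n : ℕ) (ω : ℝ≥0 → ℝ) :
    ∃ N : ℕ, ∀ t : ℝ≥0, (t : WithTop ℝ≥0) ≤ slePointLocTime κ z n ω →
      |cotArg (sleDriving κ ω) z t| < |z.re / z.im| + 1 + N := by
  have hcont := continuous_sleStoppedSlope (κ := κ) hz n ω
  obtain ⟨C, hC⟩ := isCompact_Icc.exists_bound_of_continuousOn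
    (s := Icc (0 : ℝ≥0) ((n : ℝ≥0) + 1)) hcont.continuousOn
  obtain ⟨N, hN⟩ := exists_nat_gt C
  refine ⟨N, fun t ht ↦ ?_⟩
  have htn : t ∈ Icc (0 : ℝ≥0) ((n : ℝ≥0) + 1) :=
    ⟨bot_le, WithTop.coe_le_coe.1 (ht.trans (slePointLocTime_le n ω))⟩
  have h1 := hC t htn
  rw [Real.norm_eq_abs, sleStoppedSlope_eq_cotArg hz, min_eq_left ht] at h1
  have h2 : |cotArg (sleDriving κ ω) z ((t : WithTop ℝ≥0).untopA)| = |cotArg (sleDriving κ ω) z t| := rfl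
  rw [h2] at h1
  have h3 : 0 ≤ |z.re / z.im| := abs_nonneg _
  linarith

/-- **Optional stopping at `H^n_λ`**: for `λ ≥ 1`, `0 < κ ≤ 8` and every `K`,
`λ^{1-κ/8} Ĝ(K) · P[H^n_λ ≤ ρₙ, |w_H| ≤ K] ≤ Ĝ(w₀) ≤ 1` (let `s → ∞` in
`mul_measureReal_sleHitReached_inter_le_of_lt`: the slope is bounded along `[0, ρₙ]`, so the
localisation `{H ≤ T_s ∧ ρₙ}` exhausts `{H ≤ ρₙ}`). [cite: RohdeSchramm2005, Lemma 6.3 (proof)] -/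
theorem mul_measureReal_sleHitReached_inter_le (hκ0 : 0 < κ) (hκ8 : κ ≤ 8) (hz : 0 < z.im)
    (hlam : 1 ≤ lam) (K : ℝ) (n : ℕ) :
    lam ^ (1 - (κ : ℝ) / 8) * rsGhatSlope (1 - (κ : ℝ) / 8) κ K *
        preWienerMeasure.real (sleHitReached κ z lam n ∩ {ω | |sleHitSlope κ z lam n ω| ≤ K}) ≤
      rsGhatSlope (1 - (κ : ℝ) / 8) κ (z.re / z.im) := by
  haveI := isProbabilityMeasure_preWienerMeasure'
  set w₀ : ℝ := z.re / z.im with hw₀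
  set sm : ℕ → ℝ := fun m ↦ |w₀| + 1 + m with hsm
  have h0 : ∀ m, |w₀| < sm m := fun m ↦ by
    simp only [hsm]; have : (0 : ℝ) ≤ m := Nat.cast_nonneg m; linarith
  set B : Set (ℝ≥0 → ℝ) := sleHitReached κ z lam n ∩ {ω | |sleHitSlope κ z lam n ω| ≤ K} with hB
  set Bm : ℕ → Set (ℝ≥0 → ℝ) := fun m ↦ B ∩
    {ω | slePsiHitTime κ z lam n ω ≤ sleCotArgLocTime κ z (sm m) n ω} with hBm
  -- `Bm` increases to `B`
  have hmono : Monotone Bm := by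
    intro m m' hmm' ω hω
    have hs : sm m ≤ sm m' := by simp only [hsm]; gcongr
    have hω2 : slePsiHitTime κ z lam n ω ≤ sleCotArgLocTime κ z (sm m) n ω := hω.2
    have h2 : slePsiHitTime κ z lam n ω ≤ sleCotArgLocTime κ z (sm m') n ω :=
      hω2.trans (min_le_min (sleCotArgExitTime_mono ω hs) le_rfl)
    exact ⟨hω.1, h2⟩
  have hU : (⋃ m, Bm m) = B := by
    refine subset_antisymm (iUnion_subset fun m ↦ inter_subset_left) fun ω hω ↦ ?_
    obtain ⟨N, hN⟩ := exists_nat_abs_cotArg_lt (κ := κ) hz n ω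
    refine mem_iUnion.2 ⟨N, hω, ?_⟩
    have hH := slePsiHitTime_le_locTime_of_ne_top hz hω.1
    exact le_min (hH.trans (slePointLocTime_le_sleCotArgExitTime hN)) hH
  -- the bound along the sequence and in the limit
  have hle : ∀ m, lam ^ (1 - (κ : ℝ) / 8) * rsGhatSlope (1 - (κ : ℝ) / 8) κ K *
      preWienerMeasure.real (Bm m) ≤ rsGhatSlope (1 - (κ : ℝ) / 8) κ w₀ := fun m ↦
    mul_measureReal_sleHitReached_inter_le_of_lt hκ0 hκ8 hz (h0 m) hlam K n
  have hlim : Tendsto (fun m ↦ preWienerMeasure.real (Bm m)) atTop (𝓝 (preWienerMeasure.real B)) := by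
    have h := tendsto_measure_iUnion_atTop (μ := preWienerMeasure) hmono
    rw [hU] at h
    exact ((ENNReal.tendsto_toReal (measure_ne_top _ _)).comp h).congr fun m ↦ rfl
  exact le_of_tendsto' ((hlim.const_mul _)) hle

end OptionalStopping

/-! ### Step 3: the subcritical moment bound with a profile tending to `1` -/

section Profile

/-- **A subcritical exponent with a supersolution `1 + D(1+w²)^{-β}`, `β > 0`**: for `0 < κ < 8`
there are `0 < a`, `0 < β ≤ 1`, `D ≥ 0` with `D_{a,κ}(1 + D(1+w²)^{-β}) ≤ 0` on `ℝ` (the case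
`a < κ/4` of `SLEMomentSupersolution.exists_rsSuperFamily_drift_nonpos`, with `a ≤ κ/8` and
`a ≤ (1-κ/8)/2`). [cite: RohdeSchramm2005, Lemma 6.3] -/
theorem exists_rsSuperFamily_drift_nonpos_pos {κ : ℝ} (h0 : 0 < κ) (h8 : κ < 8) :
    ∃ a β D : ℝ, 0 < a ∧ 0 < β ∧ β ≤ 1 ∧ 0 ≤ D ∧
      ∀ w, rsDriftOp κ a (rsSuperFamily β D 0) w ≤ 0 := by
  set a : ℝ := min (κ / 8) ((1 - κ / 8) / 2) with ha
  have ha0 : 0 < a := lt_min (by positivity) (by linarith)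
  have haκ : a ≤ κ / 8 := min_le_left _ _
  have ha8 : a ≤ (1 - κ / 8) / 2 := min_le_right _ _
  have h4a : 0 < 4 * a / κ := div_pos (by linarith) h0
  -- `β₀ = (8-κ)/(2κ)` and `4a/κ < min 1 β₀`
  set m : ℝ := min 1 ((8 - κ) / (2 * κ)) with hm
  have hlt : 4 * a / κ < m := by
    refine lt_min ?_ ?_
    · rw [div_lt_one h0]; linarith
    · rw [div_lt_div_iff₀ h0 (by linarith)]; nlinarith
  set β : ℝ := (4 * a / κ + m) / 2 with hβ
  have hβlo : 4 * a / κ < β := by rw [hβ]; linarith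
  have hβhi : β < m := by rw [hβ]; linarith
  have hβa : 4 * a < κ * β := by
    have := (div_lt_iff₀ h0).1 hβlo
    linarith
  have hβ1 : β ≤ 1 := (hβhi.trans_le (min_le_left _ _)).le
  have hβ0 : 2 * κ * β + κ < 8 := by
    have h := hβhi.trans_le (min_le_right _ _)
    rw [lt_div_iff₀ (by linarith)] at h
    linarith
  refine ⟨a, β, 4 * a / (κ * β - 4 * a) + 4 * a / (8 - κ - 2 * κ * β), ha0, h4a.trans hβlo, hβ1,
    add_nonneg (div_nonneg (by linarith) (by linarith)) (div_nonneg (by linarith) (by linarith)),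
    fun w ↦ ?_⟩
  exact rsSuperFamily_drift_nonpos_of_lt h0 ha0.le hβa hβ1 hβ0 le_rfl w

/-- `supₙ Ψₙ ≥ 1` (`ψ ≥ 1` before the swallowing time). [folklore] -/
theorem one_le_iSup_slePointRatioPowSeq (hz : 0 < z.im) {a : ℝ} (ha : 0 ≤ a) (ω : ℝ≥0 → ℝ) :
    (1 : ℝ≥0∞) ≤ ⨆ n, slePointRatioPowSeq κ z a n ω := by
  refine le_trans ?_ (le_iSup (fun n ↦ slePointRatioPowSeq κ z a n ω) 0)
  rw [slePointRatioPowSeq_eq hz, ← ENNReal.ofReal_one]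
  exact ENNReal.ofReal_le_ofReal (Real.one_le_rpow (one_le_derivRatio_locTime hz 0 ω) ha)

/-- **`P[E_Λ(z)] ≤ D (1+w₀²)^{-β}/(Λ^a - 1)`** for `Λ > 1`, given the supersolution
`G = 1 + D(1+w²)^{-β}` of `D_{a,κ} G ≤ 0` (`a > 0`, `β, D ≥ 0`): Markov's inequality for `S - 1`,
`S = supₙ Ψₙ ≥ max(1, Z^a 𝟙_{E})`, `E[S] ≤ G(w₀)` (`lintegral_iSup_slePointRatioPowSeq_le`).
[cite: RohdeSchramm2005, Lemma 6.3] -/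
theorem measureReal_sleRatioReach_le_of_supersolution (hκ0 : 0 < κ) {a β D : ℝ} (ha : 0 < a)
    (hβ : 0 ≤ β) (hD : 0 ≤ D) (hdrift : ∀ w, rsDriftOp κ a (rsSuperFamily β D 0) w ≤ 0)
    (hz : 0 < z.im) {Λ : ℝ} (hΛ : 1 < Λ) :
    preWienerMeasure.real (sleRatioReach κ z Λ) ≤
      D * (1 + (z.re / z.im) ^ 2) ^ (-β) / (Λ ^ a - 1) := by
  haveI := isProbabilityMeasure_preWienerMeasure'
  have _hκ := hκ0
  set G := rsSuperFamily β D 0 with hG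
  have hGc : ContDiff ℝ 2 G := contDiff_rsSuperFamily β D 0
  have hG1 : ∀ w, 1 ≤ G w := one_le_rsSuperFamily hD le_rfl
  have hGB : ∀ w, G w ≤ 1 + D + 0 := rsSuperFamily_le hβ hD le_rfl
  set w₀ : ℝ := z.re / z.im with hw₀
  have hC : ∀ (n : ℕ) (t : ℝ≥0), ∫ ω, slePointRatioPow κ z n a t ω ∂preWienerMeasure ≤ G w₀ :=
    fun n t ↦ integral_slePointRatioPow_le_apply_of_supersolution hGc hG1 hGB hdrift ha.le hz n t
  set S : (ℝ≥0 → ℝ) → ℝ≥0∞ := fun ω ↦ ⨆ n, slePointRatioPowSeq κ z a n ω with hS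
  have hSm : Measurable S := measurable_iSup_slePointRatioPowSeq κ hz a
  have hSint : ∫⁻ ω, S ω ∂preWienerMeasure ≤ ENNReal.ofReal (G w₀) :=
    lintegral_iSup_slePointRatioPowSeq_le hz ha.le hC
  have hS1 : ∀ ω, 1 ≤ S ω := fun ω ↦ one_le_iSup_slePointRatioPowSeq hz ha.le ω
  -- `E_Λ ⊆ {Λ^a ≤ S} ⊆ {Λ^a - 1 ≤ S - 1}`
  have hΛa : 1 < Λ ^ a := Real.one_lt_rpow hΛ ha
  set c : ℝ≥0∞ := ENNReal.ofReal (Λ ^ a - 1) with hc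
  have hc0 : c ≠ 0 := (ENNReal.ofReal_pos.2 (by linarith)).ne'
  have hsub : sleRatioReach κ z Λ ⊆ {ω | c ≤ S ω - 1} := by
    rintro ω ⟨t, ht, hle⟩
    have h1 := ofReal_derivRatio_rpow_le_iSup hz ha.le ω ht (κ := κ)
    have hψ0 : 0 ≤ Λ := zero_le_one.trans hΛ.le
    have h2 : ENNReal.ofReal (Λ ^ a) ≤ S ω :=
      (ENNReal.ofReal_le_ofReal (Real.rpow_le_rpow hψ0 hle ha.le)).trans h1
    have h3 : ENNReal.ofReal (Λ ^ a) - 1 ≤ S ω - 1 := tsub_le_tsub_right h2 1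
    rw [mem_setOf_eq, hc, ENNReal.ofReal_sub _ zero_le_one, ENNReal.ofReal_one]
    exact h3
  -- Markov for `S - 1`
  have hmarkov : preWienerMeasure {ω | c ≤ S ω - 1} ≤ (∫⁻ ω, (S ω - 1) ∂preWienerMeasure) / c :=
    meas_ge_le_lintegral_div (hSm.sub measurable_const).aemeasurable hc0 ENNReal.ofReal_ne_top
  have hsub1 : ∫⁻ ω, (S ω - 1) ∂preWienerMeasure = (∫⁻ ω, S ω ∂preWienerMeasure) - 1 := by
    rw [lintegral_sub measurable_const (by simp) (ae_of_all _ hS1), lintegral_const, measure_univ,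
      mul_one]
  have hnum : (∫⁻ ω, S ω ∂preWienerMeasure) - 1 ≤ ENNReal.ofReal (G w₀ - 1) := by
    rw [ENNReal.ofReal_sub _ zero_le_one, ENNReal.ofReal_one]
    exact tsub_le_tsub_right hSint 1
  have hGw : G w₀ - 1 = D * (1 + w₀ ^ 2) ^ (-β) := by
    rw [hG, rsSuperFamily_apply]; ring
  have hfin : preWienerMeasure (sleRatioReach κ z Λ) ≤
      ENNReal.ofReal (D * (1 + w₀ ^ 2) ^ (-β) / (Λ ^ a - 1)) := by
    calc preWienerMeasure (sleRatioReach κ z Λ) ≤ preWienerMeasure {ω | c ≤ S ω - 1} :=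
          measure_mono hsub
      _ ≤ (∫⁻ ω, (S ω - 1) ∂preWienerMeasure) / c := hmarkov
      _ ≤ ENNReal.ofReal (G w₀ - 1) / c := by
          rw [hsub1]; exact ENNReal.div_le_div_right hnum c
      _ = ENNReal.ofReal (D * (1 + w₀ ^ 2) ^ (-β) / (Λ ^ a - 1)) := by
          rw [hGw, hc, ← ENNReal.ofReal_div_of_pos (by linarith)]
  have hnn : 0 ≤ D * (1 + w₀ ^ 2) ^ (-β) / (Λ ^ a - 1) :=
    div_nonneg (mul_nonneg hD (rpow_nonneg (by positivity) _)) (by linarith)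
  exact ENNReal.toReal_le_of_le_ofReal hnn hfin

/-- **`p_K(Λ)`**: for `|Re x/Im x| > K ≥ 0`, `P[E_Λ(x)] ≤ D (1+K²)^{-β}/(Λ^a - 1)`.
[cite: RohdeSchramm2005, Lemma 6.3] -/
theorem measureReal_sleRatioReach_le_of_lt_abs (hκ0 : 0 < κ) {a β D : ℝ} (ha : 0 < a)
    (hβ : 0 ≤ β) (hD : 0 ≤ D) (hdrift : ∀ w, rsDriftOp κ a (rsSuperFamily β D 0) w ≤ 0)
    {Λ K : ℝ} (hΛ : 1 < Λ) (hK : 0 ≤ K) {x : ℂ} (hx : 0 < x.im) (hKx : K < |x.re / x.im|) :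
    preWienerMeasure.real (sleRatioReach κ x Λ) ≤ D * (1 + K ^ 2) ^ (-β) / (Λ ^ a - 1) := by
  have hΛa : 1 < Λ ^ a := Real.one_lt_rpow hΛ ha
  refine (measureReal_sleRatioReach_le_of_supersolution hκ0 ha hβ hD hdrift hx hΛ).trans ?_
  refine div_le_div_of_nonneg_right (mul_le_mul_of_nonneg_left ?_ hD) (by linarith)
  have hK2 : K ^ 2 ≤ (x.re / x.im) ^ 2 := by
    have h1 : K ^ 2 ≤ |x.re / x.im| ^ 2 := by nlinarith [abs_nonneg (x.re / x.im)]
    rwa [sq_abs] at h1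
  exact rpow_le_rpow_of_nonpos (by positivity) (by linarith) (neg_nonpos.2 hβ)

end Profile

/-! ### Steps 2 and 4: the renewal inequality and the induction over dyadic levels -/

section Renewal

/-- `{H^n_λ ≤ ρₙ}` is non-decreasing in `n`. [folklore] -/
theorem sleHitReached_mono (hz : 0 < z.im) (lam : ℝ) : Monotone (sleHitReached κ z lam) := by
  refine monotone_nat_of_le_succ fun n ω hω ↦ ?_
  simp only [sleHitReached, mem_setOf_eq] at hω ⊢
  rw [slePsiHitTime, hittingAfter_zero_ne_top_iff] at hω ⊢
  obtain ⟨j, hj⟩ := hω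
  obtain ⟨ρ, hρ⟩ := WithTop.ne_top_iff_exists.1 (slePointLocTime_ne_top (κ := κ) (z := z) n ω)
  refine ⟨min j ρ, ?_⟩
  simp only [mem_Ici, slePsiGauge, sub_nonneg, stoppedProcess_slePointPsi_eq] at hj ⊢
  have hmono : slePointLocTime κ z n ω ≤ slePointLocTime κ z (n + 1) ω :=
    slePointLocTime_mono hz ω n.le_succ
  have h1 : min ((min j ρ : ℝ≥0) : WithTop ℝ≥0) (slePointLocTime κ z (n + 1) ω) =
      min (j : WithTop ℝ≥0) (slePointLocTime κ z n ω) := by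
    rw [← hρ, ← WithTop.coe_min]
    exact min_eq_left ((WithTop.coe_le_coe.2 (min_le_right j ρ)).trans (hρ.le.trans hmono))
  rw [h1]
  exact hj

/-- `E_{Λλ}(z) ⊆ ⋃ₙ {H^n_λ ≤ ρₙ}` for `Λ ≥ 1` (reaching `Λλ ≥ λ` at some `t < T_z`, and `t ≤ ρₙ`
eventually). [folklore] -/
theorem sleRatioReach_mul_subset_iUnion (hz : 0 < z.im) {Λ : ℝ} (hΛ : 1 ≤ Λ) (hlam : 0 ≤ lam) :
    sleRatioReach κ z (Λ * lam) ⊆ ⋃ n, sleHitReached κ z lam n := by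
  rintro ω ⟨t, ht, hle⟩
  obtain ⟨N, hN⟩ := exists_le_slePointLocTime hz ω ht
  refine mem_iUnion.2 ⟨N, ?_⟩
  simp only [sleHitReached, mem_setOf_eq, slePsiHitTime, hittingAfter_zero_ne_top_iff]
  refine ⟨t, ?_⟩
  simp only [mem_Ici, slePsiGauge, sub_nonneg, stoppedProcess_slePointPsi_eq, min_eq_left (hN N le_rfl)]
  have h1 : lam ≤ Λ * lam := le_mul_of_one_le_left hlam hΛ
  exact h1.trans hle

/-- `{H^n_λ ≤ ρₙ} ⊆ E_λ(z)`. [folklore] -/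
theorem sleHitReached_subset_sleRatioReach (hz : 0 < z.im) (lam : ℝ) (n : ℕ) :
    sleHitReached κ z lam n ⊆ sleRatioReach κ z lam := fun ω hω ↦
  ⟨(slePsiHitLocTime κ z lam n ω).untopA, coe_untopA_slePsiHitLocTime_lt hz ω,
    le_derivRatio_untopA_slePsiHitLocTime hz hω⟩

/-- **The renewal inequality**: `P[E_{Λλ}(z)] ≤ Ĝ(K)⁻¹ λ^{-(1-κ/8)} + p · P[E_λ(z)]` for
`λ ≥ 1`, `Λ ≥ 1`, `0 < κ ≤ 8`, whenever `P[E_Λ(x)] ≤ p` for all `x ∈ ℍ` of slope `> K` (steps 1 and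
2, then `n → ∞`). [cite: RohdeSchramm2005, Lemma 6.3] -/
theorem measureReal_sleRatioReach_mul_le (hκ0 : 0 < κ) (hκ8 : κ ≤ 8) (hz : 0 < z.im)
    (hlam : 1 ≤ lam) {Λ K p : ℝ} (hΛ : 1 ≤ Λ) (hp0 : 0 ≤ p)
    (hp : ∀ x : ℂ, 0 < x.im → K < |x.re / x.im| → preWienerMeasure.real (sleRatioReach κ x Λ) ≤ p) :
    preWienerMeasure.real (sleRatioReach κ z (Λ * lam)) ≤
      (rsGhatSlope (1 - (κ : ℝ) / 8) κ K)⁻¹ * lam ^ (-(1 - (κ : ℝ) / 8)) +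
        p * preWienerMeasure.real (sleRatioReach κ z lam) := by
  haveI := isProbabilityMeasure_preWienerMeasure'
  have hκ0' : (0 : ℝ) < κ := by exact_mod_cast hκ0
  have hκ8' : (κ : ℝ) ≤ 8 := by exact_mod_cast hκ8
  have hlam0 : 0 < lam := one_pos.trans_le hlam
  have hGK := rsGhatSlope_critical_mem_Ioc hκ0' hκ8' K
  set E := sleRatioReach κ z (Λ * lam) with hE
  set R := sleHitReached κ z lam with hR
  set c₁ : ℝ := (rsGhatSlope (1 - (κ : ℝ) / 8) κ K)⁻¹ * lam ^ (-(1 - (κ : ℝ) / 8)) with hc₁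
  -- the bound for each `n`
  have hn : ∀ n, preWienerMeasure.real (E ∩ R n) ≤
      c₁ + p * preWienerMeasure.real (sleRatioReach κ z lam) := by
    intro n
    set A₁ := R n ∩ {ω | |sleHitSlope κ z lam n ω| ≤ K} with hA₁
    set A₂ := R n ∩ {ω | K < |sleHitSlope κ z lam n ω|} with hA₂
    have hsplit : E ∩ R n ⊆ A₁ ∪ E ∩ A₂ := by
      rintro ω ⟨hωE, hωR⟩
      by_cases hK : |sleHitSlope κ z lam n ω| ≤ K
      · exact Or.inl ⟨hωR, hK⟩
      · exact Or.inr ⟨hωE, hωR, not_le.1 hK⟩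
    -- step 1
    have h1 : preWienerMeasure.real A₁ ≤ c₁ := by
      have h := mul_measureReal_sleHitReached_inter_le hκ0 hκ8 hz hlam K n
      have hpos : 0 < lam ^ (1 - (κ : ℝ) / 8) * rsGhatSlope (1 - (κ : ℝ) / 8) κ K :=
        mul_pos (rpow_pos_of_pos hlam0 _) hGK.1
      rw [mul_comm] at h
      have h' := (le_div_iff₀ hpos).2 h
      refine h'.trans ?_
      rw [hc₁, div_eq_mul_inv, mul_inv, rpow_neg hlam0.le]
      have hG1 : rsGhatSlope (1 - (κ : ℝ) / 8) κ (z.re / z.im) ≤ 1 :=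
        (rsGhatSlope_critical_mem_Ioc hκ0' hκ8' _).2
      have hinv0 : 0 ≤ (lam ^ (1 - (κ : ℝ) / 8))⁻¹ * (rsGhatSlope (1 - (κ : ℝ) / 8) κ K)⁻¹ :=
        mul_nonneg (inv_nonneg.2 (rpow_nonneg hlam0.le _)) (inv_nonneg.2 hGK.1.le)
      calc rsGhatSlope (1 - (κ : ℝ) / 8) κ (z.re / z.im) *
            ((lam ^ (1 - (κ : ℝ) / 8))⁻¹ * (rsGhatSlope (1 - (κ : ℝ) / 8) κ K)⁻¹)
          ≤ 1 * ((lam ^ (1 - (κ : ℝ) / 8))⁻¹ * (rsGhatSlope (1 - (κ : ℝ) / 8) κ K)⁻¹) :=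
            mul_le_mul_of_nonneg_right hG1 hinv0
        _ = (rsGhatSlope (1 - (κ : ℝ) / 8) κ K)⁻¹ * (lam ^ (1 - (κ : ℝ) / 8))⁻¹ := by ring
    -- step 2
    have h2 : preWienerMeasure.real (E ∩ A₂) ≤ p * preWienerMeasure.real (sleRatioReach κ z lam) := by
      refine (measureReal_reach_mul_inter_le hz hlam hp n).trans ?_
      exact mul_le_mul_of_nonneg_left (measureReal_mono (inter_subset_left.trans
        (sleHitReached_subset_sleRatioReach hz lam n))) hp0
    calc preWienerMeasure.real (E ∩ R n) ≤ preWienerMeasure.real (A₁ ∪ E ∩ A₂) :=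
          measureReal_mono hsplit
      _ ≤ preWienerMeasure.real A₁ + preWienerMeasure.real (E ∩ A₂) := measureReal_union_le _ _
      _ ≤ c₁ + p * preWienerMeasure.real (sleRatioReach κ z lam) := add_le_add h1 h2
  -- `n → ∞`
  have hmono : Monotone fun n ↦ E ∩ R n := fun n m hnm ↦
    inter_subset_inter_right _ (sleHitReached_mono hz lam hnm)
  have hU : (⋃ n, E ∩ R n) = E := by
    rw [← inter_iUnion]
    exact inter_eq_left.2 (sleRatioReach_mul_subset_iUnion hz hΛ hlam0.le)
  have hlim : Tendsto (fun n ↦ preWienerMeasure.real (E ∩ R n)) atTop (𝓝 (preWienerMeasure.real E)) := by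
    have h := tendsto_measure_iUnion_atTop (μ := preWienerMeasure) hmono
    rw [hU] at h
    exact ((ENNReal.tendsto_toReal (measure_ne_top _ _)).comp h).congr fun m ↦ rfl
  exact le_of_tendsto' hlim hn

/-- `E_λ` is non-increasing in the level. [folklore] -/
theorem sleRatioReach_antitone (κ : ℝ≥0) (z : ℂ) {lam lam' : ℝ} (h : lam ≤ lam') :
    sleRatioReach κ z lam' ⊆ sleRatioReach κ z lam := fun _ ⟨t, ht, hle⟩ ↦ ⟨t, ht, h.trans hle⟩

/-- **The tail of Rohde–Schramm's `Z(z)` at the critical exponent**: for `0 < κ < 8` there is `C`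
with `P[ψ(z) reaches λ before T_z] ≤ C λ^{-(1-κ/8)}` for all `z ∈ ℍ` and `λ ≥ 1` (renewal
inequality with `Λ = 2` and `K` large, induction over the dyadic levels `λ = 2^m`, monotonicity in
`λ`). Rohde–Schramm (2005), Lemma 6.3 gives `E[Z^a] < ∞` exactly for `a < 1 - κ/8`; this is the
endpoint tail bound (Beffara (2008), Prop. 4; Lawler (2005), Thm. 7.9, on the derivative side).
[cite: Beffara2008, Prop. 4] -/
theorem exists_measureReal_sleRatioReach_le (hκ0 : 0 < κ) (hκ8 : κ < 8) :
    ∃ C : ℝ, 0 < C ∧ ∀ z : ℂ, 0 < z.im → ∀ lam : ℝ, 1 ≤ lam →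
      preWienerMeasure.real (sleRatioReach κ z lam) ≤ C * lam ^ (-(1 - (κ : ℝ) / 8)) := by
  haveI := isProbabilityMeasure_preWienerMeasure'
  have hκ0' : (0 : ℝ) < κ := by exact_mod_cast hκ0
  have hκ8' : (κ : ℝ) < 8 := by exact_mod_cast hκ8
  set a₀ : ℝ := 1 - (κ : ℝ) / 8 with ha₀
  have ha₀0 : 0 < a₀ := by rw [ha₀]; linarith
  -- step 3: the profile
  obtain ⟨a, β, D, ha, hβ, hβ1, hD, hdrift⟩ := exists_rsSuperFamily_drift_nonpos_pos hκ0' hκ8'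
  -- choice of `K`: `2^{a₀} p_K(2) ≤ 1/2`
  set q : ℝ := (2 : ℝ) ^ a - 1 with hq
  have hq0 : 0 < q := by rw [hq]; linarith [Real.one_lt_rpow (by norm_num : (1 : ℝ) < 2) ha]
  have htend : Tendsto (fun K : ℝ ↦ D * (1 + K ^ 2) ^ (-β) / q) atTop (𝓝 (D * 0 / q)) := by
    have h1 : Tendsto (fun K : ℝ ↦ 1 + K ^ 2) atTop atTop :=
      tendsto_atTop_add_const_left _ _ (tendsto_pow_atTop two_ne_zero)
    exact (((tendsto_rpow_neg_atTop hβ).comp h1).const_mul D).div_const q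
  rw [mul_zero, zero_div] at htend
  have hε : (0 : ℝ) < (2 : ℝ) ^ (-a₀) / 2 := by positivity
  obtain ⟨K₀, hK₀⟩ := eventually_atTop.1 (htend.eventually (Iic_mem_nhds hε))
  set K : ℝ := max K₀ 0 with hK
  have hK0 : 0 ≤ K := le_max_right _ _
  set p : ℝ := D * (1 + K ^ 2) ^ (-β) / q with hp
  have hp0 : 0 ≤ p := div_nonneg (mul_nonneg hD (rpow_nonneg (by positivity) _)) hq0.le
  have hple : p ≤ (2 : ℝ) ^ (-a₀) / 2 := hK₀ K (le_max_left _ _)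
  have hpK : ∀ x : ℂ, 0 < x.im → K < |x.re / x.im| → preWienerMeasure.real (sleRatioReach κ x 2) ≤ p :=
    fun x hx hKx ↦ measureReal_sleRatioReach_le_of_lt_abs hκ0 ha hβ.le hD hdrift one_lt_two hK0 hx hKx
  -- the constants
  set g : ℝ := (rsGhatSlope (1 - (κ : ℝ) / 8) κ K)⁻¹ with hg
  have hGK := rsGhatSlope_critical_mem_Ioc hκ0' hκ8'.le K
  have hg0 : 0 < g := inv_pos.2 hGK.1
  set V : ℝ := max 1 (2 * (2 : ℝ) ^ a₀ * g) with hV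
  have hV1 : 1 ≤ V := le_max_left _ _
  have hV2 : 2 * (2 : ℝ) ^ a₀ * g ≤ V := le_max_right _ _
  -- induction over dyadic levels
  have hdy : ∀ m : ℕ, ∀ z : ℂ, 0 < z.im →
      preWienerMeasure.real (sleRatioReach κ z ((2 : ℝ) ^ m)) ≤ V * ((2 : ℝ) ^ m) ^ (-a₀) := by
    intro m
    induction m with
    | zero =>
      intro z hz
      simp only [pow_zero, Real.one_rpow, mul_one]
      exact measureReal_le_one.trans hV1
    | succ m ih =>
      intro z hz
      have h2m : (1 : ℝ) ≤ (2 : ℝ) ^ m := one_le_pow₀ (by norm_num)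
      have h := measureReal_sleRatioReach_mul_le hκ0 hκ8.le hz h2m (Λ := 2) (by norm_num) hp0 hpK
      rw [show (2 : ℝ) * 2 ^ m = 2 ^ (m + 1) by ring] at h
      refine h.trans ?_
      have h2m0 : (0 : ℝ) < (2 : ℝ) ^ m := by positivity
      have hih := ih z hz
      -- `g (2^m)^{-a₀} + p V (2^m)^{-a₀} ≤ V (2^{m+1})^{-a₀}`
      have hpow : ((2 : ℝ) ^ (m + 1)) ^ (-a₀) = (2 : ℝ) ^ (-a₀) * ((2 : ℝ) ^ m) ^ (-a₀) := by
        rw [pow_succ, mul_comm, Real.mul_rpow (by norm_num) h2m0.le]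
      rw [hpow]
      have hx0 : 0 < ((2 : ℝ) ^ m) ^ (-a₀) := rpow_pos_of_pos h2m0 _
      have hkey : g + p * V ≤ V * (2 : ℝ) ^ (-a₀) := by
        have h2a : (2 : ℝ) ^ (-a₀) * (2 : ℝ) ^ a₀ = 1 := by
          rw [← Real.rpow_add (by norm_num), neg_add_cancel, Real.rpow_zero]
        have hVpos : 0 ≤ V := zero_le_one.trans hV1
        have hpV : p * V ≤ (2 : ℝ) ^ (-a₀) / 2 * V := mul_le_mul_of_nonneg_right hple hVpos
        have hgV : g ≤ (2 : ℝ) ^ (-a₀) / 2 * V := by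
          have := mul_le_mul_of_nonneg_left hV2 (le_of_lt (half_pos (rpow_pos_of_pos two_pos (-a₀))))
          calc g = (2 : ℝ) ^ (-a₀) / 2 * (2 * (2 : ℝ) ^ a₀ * g) := by
                field_simp
                nlinarith [h2a]
            _ ≤ (2 : ℝ) ^ (-a₀) / 2 * V := this
        nlinarith
      calc g * ((2 : ℝ) ^ m) ^ (-a₀) + p * preWienerMeasure.real (sleRatioReach κ z ((2 : ℝ) ^ m))
          ≤ g * ((2 : ℝ) ^ m) ^ (-a₀) + p * (V * ((2 : ℝ) ^ m) ^ (-a₀)) := by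
            gcongr
        _ = (g + p * V) * ((2 : ℝ) ^ m) ^ (-a₀) := by ring
        _ ≤ (V * (2 : ℝ) ^ (-a₀)) * ((2 : ℝ) ^ m) ^ (-a₀) := mul_le_mul_of_nonneg_right hkey hx0.le
        _ = V * ((2 : ℝ) ^ (-a₀) * ((2 : ℝ) ^ m) ^ (-a₀)) := by ring
  -- general `λ ≥ 1`: `2^m ≤ λ < 2^{m+1}`
  refine ⟨V * (2 : ℝ) ^ a₀, by positivity, fun z hz lam hlam ↦ ?_⟩
  obtain ⟨m, hm1, hm2⟩ : ∃ m : ℕ, (2 : ℝ) ^ m ≤ lam ∧ lam < (2 : ℝ) ^ (m + 1) := by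
    obtain ⟨m, hm⟩ := exists_nat_pow_near hlam one_lt_two
    exact ⟨m, hm.1, hm.2⟩
  have hlam0 : 0 < lam := one_pos.trans_le hlam
  have h2m0 : (0 : ℝ) < (2 : ℝ) ^ m := by positivity
  calc preWienerMeasure.real (sleRatioReach κ z lam)
      ≤ preWienerMeasure.real (sleRatioReach κ z ((2 : ℝ) ^ m)) :=
        measureReal_mono (sleRatioReach_antitone κ z hm1)
    _ ≤ V * ((2 : ℝ) ^ m) ^ (-a₀) := hdy m z hz
    _ = V * (2 : ℝ) ^ a₀ * ((2 : ℝ) ^ (m + 1)) ^ (-a₀) := by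
        have hpow : ((2 : ℝ) ^ (m + 1)) ^ (-a₀) = (2 : ℝ) ^ (-a₀) * ((2 : ℝ) ^ m) ^ (-a₀) := by
          rw [pow_succ, mul_comm, Real.mul_rpow (by norm_num) h2m0.le]
        have h2a : (2 : ℝ) ^ a₀ * (2 : ℝ) ^ (-a₀) = 1 := by
          rw [← Real.rpow_add two_pos, add_neg_cancel, Real.rpow_zero]
        rw [hpow, show V * ((2 : ℝ) ^ m) ^ (-a₀) = V * ((2 : ℝ) ^ a₀ * (2 : ℝ) ^ (-a₀)) *
          ((2 : ℝ) ^ m) ^ (-a₀) by rw [h2a, mul_one]]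
        ring
    _ ≤ V * (2 : ℝ) ^ a₀ * lam ^ (-a₀) := by
        refine mul_le_mul_of_nonneg_left ?_ (by positivity)
        have h2m1 : (0 : ℝ) < (2 : ℝ) ^ (m + 1) := by positivity
        exact (Real.rpow_le_rpow_iff_of_neg h2m1 hlam0 (neg_lt_zero.2 ha₀0)).2 hm2.le

end Renewal

/-! ### The one-point estimate for the trace at the critical exponent -/

section Trace

/-- **`{dist(z, γ) ≤ ε} ⊆ E_λ(z)` with `λ = Im z/(128 π ε)`** on the event that the chain is
generated by a curve: otherwise `ψ < λ` on `[0, T_z)` and Rohde–Schramm's (6.2) (Koebe, tree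
constant `1/(64π)`) gives `dist(z, γ) ≥ Im z/(64πλ) = 2ε`. [cite: RohdeSchramm2005, eq. (6.2)] -/
theorem mem_sleRatioReach_of_infDist_sleTrace_le (hz : 0 < z.im) {ε : ℝ} (hε : 0 < ε)
    {ω : ℝ≥0 → ℝ} (hgen : ∃ γ, IsGeneratedByCurve (sleDriving κ ω) γ)
    (hdist : infDist z (range (sleTrace κ ω)) ≤ ε) :
    ω ∈ sleRatioReach κ z (z.im / (128 * π * ε)) := by
  by_contra hnot
  have hall : ∀ t : ℝ≥0, (t : WithTop ℝ≥0) < swallowingTime (sleDriving κ ω) z →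
      derivRatio (sleDriving κ ω) z t ≤ z.im / (128 * π * ε) := by
    intro t ht
    by_contra hlt
    exact hnot ⟨t, ht, (not_le.1 hlt).le⟩
  have hgen' := isGeneratedByCurve_trace hgen
  have hle := hgen'.le_infDist_range_of_derivRatio_le (continuous_sleDriving κ ω) hz hall
  have heq : z.im / (64 * π * (z.im / (128 * π * ε))) = 2 * ε := by
    field_simp
    ring
  rw [heq] at hle
  have hle' : 2 * ε ≤ infDist z (range (sleTrace κ ω)) := hle
  linarith

/-- **The sharp one-point estimate for the SLE_κ trace, upper half** (`0 < κ < 8`, under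
`HasSLETrace κ`): there is `C` such that for all `z ∈ ℍ` and `ε > 0`,
`P[dist(z, γ[0,∞)) ≤ ε] ≤ C (ε/Im z)^{1-κ/8}` — Beffara (2008), Prop. 4 (upper half of
`P(B(z,ε) ∩ γ ≠ ∅) ≍ (ε/Im z)^{1-κ/8}(sin arg z)^{8/κ-1}`, without the angular factor); Lawler (2005),
Thm. 7.9 (upper half, uniformly in `Re z`). From `exists_measureReal_sleRatioReach_le` and (6.2).
The measure of the (possibly non-measurable) event is its outer measure.
[cite: Beffara2008, Prop. 4] -/
theorem measure_infDist_sleTrace_le_critical (hκ0 : 0 < κ) (hκ8 : κ < 8) (hT : HasSLETrace κ) :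
    ∃ C : ℝ≥0, ∀ {z : ℂ}, 0 < z.im → ∀ {ε : ℝ}, 0 < ε →
      preWienerMeasure {ω | infDist z (range (sleTrace κ ω)) ≤ ε} ≤
        C * ENNReal.ofReal ((ε / z.im) ^ (1 - (κ : ℝ) / 8)) := by
  haveI := isProbabilityMeasure_preWienerMeasure'
  obtain ⟨C, hC0, hC⟩ := exists_measureReal_sleRatioReach_le hκ0 hκ8
  set a₀ : ℝ := 1 - (κ : ℝ) / 8 with ha₀
  have ha₀0 : 0 < a₀ := by
    have : (κ : ℝ) < 8 := by exact_mod_cast hκ8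
    rw [ha₀]; linarith
  set C' : ℝ := max C 1 * (128 * π) ^ a₀ with hC'
  have hC'0 : 0 ≤ C' := by positivity
  refine ⟨C'.toNNReal, fun {z} hz {ε} hε ↦ ?_⟩
  set A : Set (ℝ≥0 → ℝ) := {ω | infDist z (range (sleTrace κ ω)) ≤ ε} with hA
  set Good : Set (ℝ≥0 → ℝ) := {ω | ∃ γ, IsGeneratedByCurve (sleDriving κ ω) γ} with hGood
  have hGc : preWienerMeasure Goodᶜ = 0 := by
    have h : ∀ᵐ ω ∂preWienerMeasure, ω ∈ Good := hT
    exact mem_ae_iff.1 (Filter.eventually_iff.1 h)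
  set lam : ℝ := z.im / (128 * π * ε) with hlam
  have hsub : A ⊆ sleRatioReach κ z lam ∪ Goodᶜ := by
    intro ω hω
    by_cases hg : ω ∈ Good
    · exact Or.inl (mem_sleRatioReach_of_infDist_sleTrace_le hz hε hg hω)
    · exact Or.inr hg
  -- the real bound `P[E_λ] ≤ C' (ε/Im z)^{a₀}`
  have hratio : (ε / z.im) = (128 * π)⁻¹ * lam⁻¹ := by
    rw [hlam]; field_simp
  have hbound : preWienerMeasure.real (sleRatioReach κ z lam) ≤ C' * (ε / z.im) ^ a₀ := by
    have h128 : (0 : ℝ) < 128 * π := by positivity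
    have hlam0 : 0 < lam := by rw [hlam]; positivity
    have hrw : C' * (ε / z.im) ^ a₀ = max C 1 * lam ^ (-a₀) := by
      rw [hratio, Real.mul_rpow (inv_nonneg.2 h128.le) (inv_nonneg.2 hlam0.le),
        Real.inv_rpow h128.le, Real.inv_rpow hlam0.le, Real.rpow_neg hlam0.le, hC']
      field_simp
    rw [hrw]
    rcases le_or_gt 1 lam with h1 | h1
    · exact (hC z hz lam h1).trans (mul_le_mul_of_nonneg_right (le_max_left _ _)
        (rpow_nonneg hlam0.le _))
    · -- `λ < 1`: the bound is `≥ 1`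
      have hge : (1 : ℝ) ≤ lam ^ (-a₀) := Real.one_le_rpow_of_pos_of_le_one_of_nonpos hlam0 h1.le
        (neg_nonpos.2 ha₀0.le)
      calc preWienerMeasure.real (sleRatioReach κ z lam) ≤ 1 := measureReal_le_one
        _ ≤ max C 1 * lam ^ (-a₀) := by nlinarith [le_max_right C 1]
  calc preWienerMeasure A ≤ preWienerMeasure (sleRatioReach κ z lam ∪ Goodᶜ) := measure_mono hsub
    _ ≤ preWienerMeasure (sleRatioReach κ z lam) + preWienerMeasure Goodᶜ := measure_union_le _ _
    _ = preWienerMeasure (sleRatioReach κ z lam) := by rw [hGc, add_zero]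
    _ = ENNReal.ofReal (preWienerMeasure.real (sleRatioReach κ z lam)) :=
        (ENNReal.ofReal_toReal (measure_ne_top _ _)).symm
    _ ≤ ENNReal.ofReal (C' * (ε / z.im) ^ a₀) := ENNReal.ofReal_le_ofReal hbound
    _ = (C'.toNNReal : ℝ≥0∞) * ENNReal.ofReal ((ε / z.im) ^ a₀) := by
        rw [ENNReal.ofReal_mul hC'0]
        rfl

/-- **The sharp one-point estimate, unconditionally for `0 < κ < 8`** (the trace exists by
Rohde–Schramm's Thm. 5.1, `hasSLETrace_of_ne_eight_apply`): there is `C` such that for all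
`z ∈ ℍ` and `ε > 0`, `P[dist(z, γ[0,∞)) ≤ ε] ≤ C (ε/Im z)^{1-κ/8}`. Beffara (2008), Prop. 4
(upper half); Lawler (2005), Thm. 7.9 (upper half). [cite: Beffara2008, Prop. 4] -/
theorem measure_infDist_sleTrace_le_critical' (hκ0 : 0 < κ) (hκ8 : κ < 8) :
    ∃ C : ℝ≥0, ∀ {z : ℂ}, 0 < z.im → ∀ {ε : ℝ}, 0 < ε →
      preWienerMeasure {ω | infDist z (range (sleTrace κ ω)) ≤ ε} ≤
        C * ENNReal.ofReal ((ε / z.im) ^ (1 - (κ : ℝ) / 8)) :=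
  measure_infDist_sleTrace_le_critical hκ0 hκ8 (hasSLETrace_of_ne_eight_apply hκ8.ne)

/-- **The sharp one-point upper estimate in the local form of the dimension files**: for every
compact `K ⊆ ℍ` there are `c₂ < ∞`, `ε₀ > 0` with `P[dist(z, γ[0,∞)) ≤ ε] ≤ c₂ ε^{1-κ/8}` for
`z ∈ K`, `0 < ε ≤ ε₀` — the hypothesis `hA` of `ae_dimH_range_sleTrace_le_of_onePoint_upper'`
(`CritPercSLEDimensionUpper.lean`) and the diagonal of the two-point hypothesis of
`CritPercSLEDimensionLower.lean`, here with `ε₀ = 1` and `c₂ = C (min_K Im)^{-(1-κ/8)}`.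
[cite: Beffara2008, Prop. 4] -/
theorem onePoint_upper_local_critical (hκ0 : 0 < κ) (hκ8 : κ < 8) (hT : HasSLETrace κ) :
    ∀ K : Set ℂ, IsCompact K → K ⊆ UpperHalfPlane.upperHalfPlaneSet →
      ∃ c₂ : ℝ≥0∞, c₂ ≠ ⊤ ∧ ∃ ε₀ : ℝ, 0 < ε₀ ∧ ∀ ε : ℝ, 0 < ε → ε ≤ ε₀ → ∀ z ∈ K,
        preWienerMeasure {ω | infDist z (range (sleTrace κ ω)) ≤ ε} ≤
          c₂ * ENNReal.ofReal (ε ^ (1 - (κ : ℝ) / 8)) := by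
  obtain ⟨C, hC⟩ := measure_infDist_sleTrace_le_critical hκ0 hκ8 hT
  set a₀ : ℝ := 1 - (κ : ℝ) / 8 with ha₀
  have ha₀0 : 0 ≤ a₀ := by
    have : (κ : ℝ) < 8 := by exact_mod_cast hκ8
    rw [ha₀]; linarith
  intro K hK hKH
  rcases K.eq_empty_or_nonempty with rfl | hne
  · exact ⟨0, ENNReal.zero_ne_top, 1, one_pos, fun ε _ _ z hz ↦ absurd hz (Set.notMem_empty z)⟩
  · obtain ⟨z₀, hz₀K, hmin⟩ := hK.exists_isMinOn hne Complex.continuous_im.continuousOn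
    have hy : 0 < z₀.im := hKH hz₀K
    refine ⟨C * ENNReal.ofReal (z₀.im ^ (-a₀)), ENNReal.mul_ne_top ENNReal.coe_ne_top ENNReal.ofReal_ne_top,
      1, one_pos, fun ε hε _ z hz ↦ ?_⟩
    have hzim : z₀.im ≤ z.im := hmin hz
    have hz' : 0 < z.im := hy.trans_le hzim
    refine (hC hz' hε).trans ?_
    rw [mul_assoc, ← ENNReal.ofReal_mul (rpow_nonneg hy.le _)]
    gcongr
    rw [div_rpow hε.le hz'.le, rpow_neg hy.le, div_eq_mul_inv, mul_comm]
    exact mul_le_mul_of_nonneg_right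
      (inv_anti₀ (rpow_pos_of_pos hy a₀) (rpow_le_rpow hy.le hzim ha₀0)) (rpow_nonneg hε.le a₀)

/-- The local form, unconditionally for `0 < κ < 8`. [cite: Beffara2008, Prop. 4] -/
theorem onePoint_upper_local_critical' (hκ0 : 0 < κ) (hκ8 : κ < 8) :
    ∀ K : Set ℂ, IsCompact K → K ⊆ UpperHalfPlane.upperHalfPlaneSet →
      ∃ c₂ : ℝ≥0∞, c₂ ≠ ⊤ ∧ ∃ ε₀ : ℝ, 0 < ε₀ ∧ ∀ ε : ℝ, 0 < ε → ε ≤ ε₀ → ∀ z ∈ K,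
        preWienerMeasure {ω | infDist z (range (sleTrace κ ω)) ≤ ε} ≤
          c₂ * ENNReal.ofReal (ε ^ (1 - (κ : ℝ) / 8)) :=
  onePoint_upper_local_critical hκ0 hκ8 (hasSLETrace_of_ne_eight_apply hκ8.ne)

end Trace

end Literature.Probability.RandomPlanarGeometry
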